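import Literature.AlgebraicGeometry.Resolution.KangarooAtlasCert
/-!
# Kangaroo atlas — the Bravo–Villamayor elimination algebra along the point-blowup walk: computable twin and certified rows

Sources.  [BV10] = A. Bravo, O. Villamayor, *Singularities in positive characteristic, stratification and
simplification of the singular locus*, Adv. Math. 224 (2010) = arXiv:0807.4308: for a Rees algebra `𝒢` on `V^{(d)}`
and a transversal projection `β : V^{(d)} → V^{(d-1)}` the ELIMINATION ALGEBRA `ℛ_{𝒢,β} ⊂ 𝒪_{V^{(d-1)}}[W]`
(¶2.7–2.9; Example 5 = Hauser's surface `Z² + Y⁷ + YX⁴` in characteristic 2, where `ℛ_𝒢 = ⟨(Y³+X²)²⟩W`, of order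
`4`, and after the `Y`-chart `ℛ_{𝒢₁} = ⟨Y³(Y+X²)²⟩W`, of order `5`, while `𝒢₁` has order `5/2`).
[BeV13] = A. Benito, O. Villamayor, Compos. Math. 149 (2013) = arXiv:1004.1803: `p`-presentations, the slope,
`H-ord^{(d-1)}(𝒢)(x) = min {ν(a_{p^e})/p^e, ord(ℛ_{𝒢,β})(β(x))}` for a well-adapted presentation (Thm 5.7, Cor. 7.3),
the transforms `(ℛ_{𝒢,β})_r` (3.2 (ii)), the tight monomial algebra and `H-ord_r ≥ ord(𝔐_r W^s)` ((7.7.1)), the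
strong monomial case (Def. 7.10, Thm 7.11).  [BeV12] = A. Benito, O. Villamayor, Math. Ann. 353 (2012) =
arXiv:1103.3464: GOOD points `H-ord = ord((ℛ)_r)` / BAD points `ν(a_{p^e})/p^e < ord((ℛ)_r)` (Def. 4.2), good / bad
exceptional hypersurfaces `h_i = α_i` / `h_i < α_i` (Def. 4.3).  [EV07] = S. Encinas, O. Villamayor, *Rees algebras
and resolution of singularities*, arXiv:math/0702836, Thm 4.1 (Giraud): `𝒢' ⊂ G(𝒢)' ⊂ G(𝒢')`.

What is computed (the cell's DERIVED readings D8-1 – D8-3 of INVARIANTS-g8 §54–§62 — derivations of the cell, checked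
below on printed rows, NOT statements of the papers):
* D8-1: for `f = x^q + F(u)` (`q = p^e`, `F` cleaned) and `𝒢 = Diff(𝒪[fW^q])`, the elimination algebra w.r.t. the
  projection forgetting `x` is, up to integral closure, `A(F) := 𝔽_p[u][(∂^{(b)}F) W^{q-|b|} : 1 ≤ |b| ≤ q-1]`
  (Hasse derivatives in `u`) — `freshGens`; on [BV10] Example 5 this gives the printed `⟨Y⁶+X⁴⟩W` (`bv10_ex5_root`);
* the transform law of [BeV13] 3.2 (ii) for a weight-`m` generator at the point `b` of the `u_j`-chart:
  `g W^m ↦ (g^*/u_j^m)(u + b) W^m` — `transportGen`; on [BV10] Example 5 it gives the printed `⟨Y³(Y+X²)²⟩W`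
  (`bv10_ex5_chart`);
* the readings at a state: `S·ord((ℛ)_r)(x̄_r)` (`S` = a common multiple of the weights, an explicit argument),
  `S·ord(A(F_r))`, the colour BAD `⟺ ν(F_r)·S < S·ord((ℛ)_r)·q`… precisely `ordF * S < ordRS * q`, the exceptional
  orders `S·α_i`, and the weak-monomial flag `S·ord((ℛ)_r) = Σ_{i : r_i > 0} S·α_i`.
By D8-2/D8-3 (INVARIANTS-g8 §60: `(ℛ)_r ⊂` closure of `A(F_r)` by [EV07] Thm 4.1, and `ord A(F_r) ≥ ν(F_r)/q`
because a Hasse derivative of order `|b|` lowers the order by at most `|b|`), on this family `H-ord = ν(F_r)/q`, the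
tight monomial algebra is `(u^r)W^q`, the slack `H-ord − ord(𝔐_r W^s)` is `shade/q` and the strong monomial case is
`shade = 0`: those columns are Hauser's `(ord F, r, shade)` of `KangarooAtlasCert` and are not re-typed here.

CERTIFIED ROWS (`decide`): [BV10] Example 5 (both printed algebras and both printed orders); the readings along
Hauser's kangaroo path and his control path [Hauser 2010, §G]; the atlas row `bp-p2e2-y9z10` (`q = 4`), the one
walk of the m = 2 census (`pub-rosobs-carver-g8/preview`, 130 014 edges) at which the shade increases from a node whose
transported elimination algebra is weakly monomial.  A CERTIFICATE of finitely many computations and a typing of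
the reading / event predicates — not a theorem about resolution.  AI review is weaker than expert review.
-/

namespace Literature.AlgebraicGeometry.Resolution.KangarooAtlasCert

/-! ## Hasse derivatives and the fresh algebra `A(F)` -/

/-- componentwise `b ≤ e`. [folklore] -/
def monLE (b e : Mon) : Bool := (List.range e.length).all (fun i => b.getD i 0 ≤ e.getD i 0)

/-- the Hasse derivative `∂^{(b)}` on sparse polynomials over `𝔽_p`: `u^e ↦ (∏ C(e_i, b_i)) u^{e−b}`.
[cite: BravoVillamayor2010, ¶2.8 (the operators Δ^α of the Taylor expansion)] -/
def hasseFp (p : ℕ) (b : Mon) (P : Poly) : Poly :=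
  normalize p (((P.filter (fun t => monLE b t.1)).map (fun t =>
    ((List.range t.1.length).map (fun i => t.1.getD i 0 - b.getD i 0),
      t.2 * ((List.range t.1.length).map (fun i => Nat.choose (t.1.getD i 0) (b.getD i 0))).prod))))

/-- all exponent vectors with `m` entries and total degree `n`. [folklore] -/
def monsOfDeg : ℕ → ℕ → List Mon
  | 0, n => if n = 0 then [[]] else []
  | m + 1, n => (List.range (n + 1)).flatMap (fun k => (monsOfDeg m (n - k)).map (fun rest => k :: rest))

/-- a generator `g W^m` of an algebra over `𝔽_p[u]`: the pair `(g, m)`. [cite: BravoVillamayor2010, ¶2.7] -/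
abbrev Gen := Poly × ℕ

/-- the nonzero `(∂^{(b)}F) W^{q−|b|}`, `1 ≤ |b| ≤ q − 1`, in `m` variables: generators of the cell's fresh algebra `A(F)`
(DERIVED reading D8-1 of the elimination algebra of `Diff(𝒪[(x^q + F)W^q])`; checked on the printed Example 5 below).
[cite: BravoVillamayor2010, ¶2.8–2.9 and Example 5] -/
def freshGens (p q m : ℕ) (F : Poly) : List Gen :=
  ((List.range q).filter (fun n => 1 ≤ n)).flatMap (fun n => (monsOfDeg m n).filterMap (fun b =>
    let g := hasseFp p b F
    if g.isEmpty then none else some (g, q - n)))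

/-! ## Orders (scaled by a common multiple `S` of the weights) -/

/-- least exponent of `u_i` in `P` (`0` for `P = 0`, never used). [folklore] -/
def leastExp (i : ℕ) (P : Poly) : ℕ :=
  match P with
  | [] => 0
  | t :: rest => rest.foldl (fun a s => min a (s.1.getD i 0)) (t.1.getD i 0)

/-- minimum of a list of naturals (`none` if empty). [folklore] -/
def minNat : List ℕ → Option ℕ
  | [] => none
  | x :: rest => some (rest.foldl min x)

/-- `S · ord(⊕ gens)(0) = min S·ν(g)/m` (exact when every weight divides `S`). [cite: BravoVillamayor2010, 2.2] -/
def algOrdS (S : ℕ) (gens : List Gen) : Option ℕ := minNat (gens.map (fun g => ord g.1 * S / g.2))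

/-- `S · (order of the algebra along the hypersurface u_i = 0)` = `min S·ord_{u_i}(g)/m` — for an exceptional `u_i`
this is `S·α_i`, `α_i` the exponent of `H_i` in the monomial part of `(ℛ)_r`. [cite: BenitoVillamayoru2011, Def. 4.3] -/
def algOrdVarS (S i : ℕ) (gens : List Gen) : Option ℕ := minNat (gens.map (fun g => leastExp i g.1 * S / g.2))

/-! ## Transport of the elimination algebra along the projected walk -/

/-- total transform of a weight-`m` generator in the `u_j`-chart, divided by `u_j^m`; `none` if `ν(g) < m`
(the centre would not lie in `Sing`). [cite: BenitoVillamayoru2013, 3.2 (ii)] -/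
def chartW (j m : ℕ) (P : Poly) : Option Poly :=
  if P.all (fun t => m ≤ deg t.1) then some (P.map (fun t => (t.1.set j (deg t.1 - m), t.2))) else none

/-- one generator of `(ℛ)_{r+1}` from one of `(ℛ)_r` at the point `b` of the `u_j`-chart. [cite: BenitoVillamayoru2013, 3.2 (ii)] -/
def transportGen (p j : ℕ) (b : List ℕ) (g : Gen) : Option Gen :=
  (chartW j g.2 g.1).map (fun h => (translate p b h, g.2))

/-- `(ℛ)_r ↦ (ℛ)_{r+1}`. [cite: BenitoVillamayoru2013, 3.2 (ii)] -/
def transport (p j : ℕ) (b : List ℕ) (gens : List Gen) : Option (List Gen) := gens.mapM (transportGen p j b)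

/-- a state of the walk together with generators of the transported elimination algebra `(ℛ)_r`. [cite: BenitoVillamayoru2013, 7.1–7.2] -/
structure EState where
  s : State
  gens : List Gen
  deriving Repr, DecidableEq

/-- the root: Hauser's state with empty history and the fresh algebra `A(F)` (D8-1). [cite: BravoVillamayor2010, ¶2.8] -/
def eroot (p q : ℕ) (F : Poly) : EState := ⟨⟨F, F.headD ([], 0) |>.1 |>.map (fun _ => 0)⟩, freshGens p q ((F.headD ([], 0)).1.length) F⟩

/-- one step of the walk carrying `(ℛ)_r` along. [cite: BenitoVillamayoru2013, 3.2 (ii)] -/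
def estep (p q : ℕ) (es : EState) (j : ℕ) (b : List ℕ) : Option EState :=
  match step p q es.s j b, transport p j b es.gens with
  | some s', some g' => some ⟨s', g'⟩
  | _, _ => none

/-! ## The readings at a node -/

/-- the elimination reading at a node, orders scaled by `S`: `ν(F)`, `|r|`, shade, `S·ord((ℛ)_r)`, `S·ord(A(F_r))`,
the colour (`bad = true` iff `ν(F)/q < ord((ℛ)_r)`, Def. 4.2 of [BeV12] read through Cor. 7.3 of [BeV13]), the
weak-monomial flag (`S·ord((ℛ)_r) = Σ_{i : r_i > 0} S·α_i`: locally `(ℛ)_r` is the monomial algebra on the exceptional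
curves through the point, up to integral closure), and the list `S·α_i`. [cite: BenitoVillamayoru2011, Def. 4.2–4.3] -/
structure ElimReading where
  ordF : ℕ
  absr : ℕ
  shade : ℕ
  ordRS : ℕ
  freshS : ℕ
  bad : Bool
  weakMono : Bool
  alphaS : List ℕ
  deriving Repr, DecidableEq

/-- compute the reading (`S` must be a common multiple of the weights `1, …, q−1`). [cite: BenitoVillamayoru2011, Def. 4.2–4.3] -/
def reading (p q S : ℕ) (es : EState) : ElimReading :=
  let m := ((es.s.F.headD ([], 0)).1).length
  let oR := (algOrdS S es.gens).getD 0
  let al := (List.range m).map (fun i => (algOrdVarS S i es.gens).getD 0)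
  let oF := ord es.s.F
  { ordF := oF, absr := es.s.r.sum, shade := shade es.s, ordRS := oR,
    freshS := (algOrdS S (freshGens p q m es.s.F)).getD 0,
    bad := decide (oF * S < oR * q),
    weakMono := decide (oR = ((List.range m).filter (fun i => es.s.r.getD i 0 ≠ 0)).foldl (fun a i => a + al.getD i 0) 0),
    alphaS := al }

/-- readings along a scripted path (`none` once a step fails). [folklore] -/
def etrace (p q S : ℕ) (es : EState) : List (ℕ × List ℕ) → List (Option ElimReading)
  | [] => [some (reading p q S es)]
  | (j, b) :: rest =>
      match estep p q es j b with
      | none => [some (reading p q S es), none]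
      | some es' => some (reading p q S es) :: etrace p q S es' rest

/-! ## Event predicates of one step (typed, row-wise; never asserted in general) -/

/-- the source of the step is weakly monomial and the shade increases (by D8-3: the slack `H-ord − ord(𝔐W^s)` jumps).
[cite: BenitoVillamayoru2013, (7.7.1) and Def. 7.10] -/
def IncreaseFromWeakMono (p q S : ℕ) (es : EState) (j : ℕ) (b : List ℕ) : Prop :=
  (reading p q S es).weakMono = true ∧ ∃ es', estep p q es j b = some es' ∧ shade es.s < shade es'.s

/-- the event predicate is decidable (for `decide` rows). [folklore] -/
instance (p q S : ℕ) (es : EState) (j : ℕ) (b : List ℕ) : Decidable (IncreaseFromWeakMono p q S es j b) := by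
  unfold IncreaseFromWeakMono
  cases h : estep p q es j b with
  | none => exact isFalse (by rintro ⟨_, es', h', _⟩; simp at h')
  | some es' =>
      by_cases hw : (reading p q S es).weakMono = true
      · by_cases hs : shade es.s < shade es'.s
        · exact isTrue ⟨hw, es', rfl, hs⟩
        · exact isFalse (by rintro ⟨_, e, he, hlt⟩; cases he; exact hs hlt)
      · exact isFalse (fun hc => hw hc.1)

/-- D8-2 at a node, as a checkable inequality of the scaled orders: `S·ν(F)·(1/q) ≤ S·ord(A(F)) ≤ S·ord((ℛ)_r)`, i.e.
`ordF·S ≤ freshS·q` and `freshS ≤ ordRS`. DERIVED (cell), checked row-wise. [cite: EncinasVillamayor2007, Thm. 4.1] -/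
def D82Holds (q S : ℕ) (ρ : ElimReading) : Bool := decide (ρ.ordF * S ≤ ρ.freshS * q) && decide (ρ.freshS ≤ ρ.ordRS)

/-! ## Certified rows -/

/-- [BV10] Example 5, root: `F = Y⁷ + YX⁴` (variables `(Y, X)`), `q = 2`: `A(F) = ⟨Y⁶ + X⁴⟩W` — the printed
`ℛ_𝒢 = 𝒪_{V^{(2)}}[(Y³+X²)²W]`. [cite: BravoVillamayor2010, Example 5] -/
theorem bv10_ex5_root : freshGens 2 2 2 hauserF = [([([6, 0], 1), ([0, 4], 1)], 1)] := by decide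

/-- [BV10] Example 5, after the quadratic transformation, `Y`-chart at the origin: `(ℛ_𝒢)₁ = ⟨Y⁵ + Y³X⁴⟩W = ⟨Y³(Y+X²)²⟩W`,
as printed. [cite: BravoVillamayor2010, Example 5] -/
theorem bv10_ex5_chart :
    transport 2 0 [0, 0] (freshGens 2 2 2 hauserF) = some [([([5, 0], 1), ([3, 4], 1)], 1)] := by decide

/-- [BV10] Example 5, the two printed orders: `ℛ_𝒢` has order `4` at the origin (the tangent cone is not `Z² = 0`), and
`ℛ_{𝒢₁}` has order `5` at the origin of the `Y`-chart "whereas `𝒢₁` has order `5/2`" — here `ν(F₁) = 5`, `q = 2`,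
so the point is BAD in the sense of [BeV12] Def. 4.2 (`5·1 < 5·2`). [cite: BravoVillamayor2010, Example 5] -/
theorem bv10_ex5_orders :
    algOrdS 1 (freshGens 2 2 2 hauserF) = some 4 ∧
    ((transport 2 0 [0, 0] (freshGens 2 2 2 hauserF)).map (algOrdS 1)) = some (some 5) ∧
    ((estep 2 2 (eroot 2 2 hauserF) 0 [0, 0]).map (fun es => (reading 2 2 1 es).ordF)) = some 5 ∧
    ((estep 2 2 (eroot 2 2 hauserF) 0 [0, 0]).map (fun es => (reading 2 2 1 es).bad)) = some true := by
  decide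

/-- Hauser's kangaroo path `(y,0), (z,0), (y, z=1)` [Hauser 2010, §G], `S = 1`: readings
`(ν(F), |r|, shade, ord(ℛ)_r, ord A(F_r), bad, weakMono, α)` =
`(5,0,5,4,4,bad,¬wm,(0,0)) → (5,3,2,5,4,bad,¬wm,(3,0)) → (8,6,2,9,7,bad,¬wm,(3,4)) → (9,6,3,10,8,bad,¬wm,(8,2))`:
every point is bad, the algebra never becomes weakly monomial, and D8-2 holds at each node (computation). [cite: Hauser2010, §G] -/
theorem hauser_etrace :
    etrace 2 2 1 (eroot 2 2 hauserF) hauserPath =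
      [some ⟨5, 0, 5, 4, 4, true, false, [0, 0]⟩, some ⟨5, 3, 2, 5, 4, true, false, [3, 0]⟩,
       some ⟨8, 6, 2, 9, 7, true, false, [3, 4]⟩, some ⟨9, 6, 3, 10, 8, true, false, [8, 2]⟩] := by
  decide

/-- D8-2 on the four nodes of Hauser's path (computation). [cite: EncinasVillamayor2007, Thm. 4.1] -/
theorem hauser_D82 :
    ((etrace 2 2 1 (eroot 2 2 hauserF) hauserPath).map (fun o => o.map (D82Holds 2 1))) =
      [some true, some true, some true, some true] := by
  decide

/-- Hauser's CONTROL path (third point = the origin of the `y`-chart): the walk ends in the monomial case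
`F = y⁶z³(1 + z²)`, shade `0`, and there `(ℛ)₃ = ⟨y⁸z⁴(1+z²)⟩W` IS weakly monomial, with `α = (8, 4)` above the tight
exponents `h/s = r/q = (3, 3/2)`: both exceptional curves are BAD hypersurfaces (Def. 4.3) and the point is bad, in the
strong monomial case (shade `0`; [BeV13] Thm 7.11 (ii)). (computation) [cite: BenitoVillamayoru2013, Thm 7.11] -/
theorem hauser_control_etrace :
    etrace 2 2 1 (eroot 2 2 hauserF) [(0, [0, 0]), (1, [0, 0]), (0, [0, 0])] =
      [some ⟨5, 0, 5, 4, 4, true, false, [0, 0]⟩, some ⟨5, 3, 2, 5, 4, true, false, [3, 0]⟩,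
       some ⟨8, 6, 2, 9, 7, true, false, [3, 4]⟩, some ⟨9, 9, 0, 12, 8, true, true, [8, 4]⟩] := by
  decide

/-- the kangaroo step of Hauser's path is NOT an increase from a weakly monomial source … [cite: Hauser2010, §G] -/
theorem hauser_not_from_weakmono :
    ¬ IncreaseFromWeakMono 2 2 1 ⟨⟨[([5, 3], 1), ([3, 5], 1)], [3, 3]⟩, [([([3, 6], 1), ([5, 4], 1)], 1)]⟩ 0 [0, 1] := by
  decide

/-- … whereas the atlas row `bp-p2e2-y9z10` (`x⁴ + y⁹ + z¹⁰` over `𝔽₂`, `q = 4`, `S = 6`) reaches, after the origins of the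
charts `z, y, y, y`, the state `F = y⁶z⁶ + y¹²z⁵`, `r = (6, 5)`, shade `1`, with `(ℛ)₄ = ⟨y¹⁴z⁵W³, y¹²z⁶W²⟩` weakly
monomial (`6·ord = 38 = 6·(14/3 + 5/3)`), and the next point `(y, z = 1)` has shade `2`: an increase from a weakly
monomial source (the only one among the 130 014 edges of the m = 2 census; none at `q = p`). (computation, atlas row) [folklore] -/
theorem bp_p2e2_y9z10 :
    ((((estep 2 4 (eroot 2 4 [([9, 0], 1), ([0, 10], 1)]) 1 [0, 0]).bind (fun es => estep 2 4 es 0 [0, 0])).bind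
        (fun es => estep 2 4 es 0 [0, 0])).bind (fun es => estep 2 4 es 0 [0, 0])) =
      some ⟨⟨[([12, 5], 1), ([6, 6], 1)], [6, 5]⟩, [([([14, 5], 1)], 3), ([([12, 6], 1)], 2)]⟩ ∧
    reading 2 4 6 ⟨⟨[([12, 5], 1), ([6, 6], 1)], [6, 5]⟩, [([([14, 5], 1)], 3), ([([12, 6], 1)], 2)]⟩ =
      ⟨12, 11, 1, 38, 30, true, true, [28, 10]⟩ ∧
    IncreaseFromWeakMono 2 4 6 ⟨⟨[([12, 5], 1), ([6, 6], 1)], [6, 5]⟩, [([([14, 5], 1)], 3), ([([12, 6], 1)], 2)]⟩ 0 [0, 1] := by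
  decide

/-- the fresh algebra at the root of that row: `A(y⁹ + z¹⁰) = ⟨y⁸W³, z⁸W²⟩` over `𝔽₂` (`∂_y y⁹ = y⁸`, `∂_z^{(2)} z¹⁰ = 45 z⁸ = z⁸`,
all other Hasse derivatives of order `≤ 3` vanish mod 2). (computation) [folklore] -/
theorem bp_p2e2_y9z10_root : freshGens 2 4 2 [([9, 0], 1), ([0, 10], 1)] = [([([8, 0], 1)], 3), ([([0, 8], 1)], 2)] := by
  decide

/-- a GOOD point: the state `F = yz`, `r = (1, 0)` (`q = 2`) read with the FRESH algebra `A(yz) = ⟨zW, yW⟩`: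
`ord A(F) = 1 = ν(F)/q`, not bad; `A(F)` is not weakly monomial (`zW` is not supported on the exceptional curve `y = 0`).
By D8-2 good points of the walk have `ν(F) = q` (INVARIANTS-g8 §61, D8-4). (computation) [cite: BenitoVillamayoru2011, Def. 4.2] -/
theorem good_terminal :
    freshGens 2 2 2 [([1, 1], 1)] = [([([1, 0], 1)], 1), ([([0, 1], 1)], 1)] ∧
    reading 2 2 1 ⟨⟨[([1, 1], 1)], [1, 0]⟩, freshGens 2 2 2 [([1, 1], 1)]⟩ = ⟨2, 1, 1, 1, 1, false, false, [0, 0]⟩ := by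
  decide

end Literature.AlgebraicGeometry.Resolution.KangarooAtlasCert
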